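import Summits.ABC.IUTFork.Thm311Ind1Processions
import Summits.ABC.IUTFork.Thm311Real
import Literature.IUT.HodgeTheaters.PMBaseProcessionsPrc
import HarnessLib

/-!
# [IUTchIII] Theorem 3.11 (i) (Ind1) over the REAL `l^±`-procession `Prc(†𝔇^⊢_T)` of [IUTchI] Prop. 6.9 (ii) — merge K ↔ L5

Proof-only MERGE file (D-0012; no new definitions) of the abc-iut cell (Cor. 3.12 sub-crew, seat
abc-iut-c312-1, gen 4); TAKES NO SIDE on [IUTchIII] Cor. 3.12. In file K (`Thm311Ind1Processions`, gen 2) the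
indeterminacy (Ind1) of [IUTchIII] Thm. 3.11 (i) (kurims `paper:url-4b091feeb646` p. 154: "the indeterminacies
induced by the automorphisms of the procession of `𝒟^⊢`-prime-strips `Prc(^{n,∘}𝔇^⊢_T)`") was shown to be,
at each label `j`, the union of its slices `LogShells.ind1Of j σ` over the permutations `σ` of `S^±_{j+1}`
induced by the automorphisms (in abc-iut-L5-t3's category of processions, [IUTchI] Def. 4.10) of the INDEX
SKELETON `ThetaIndex.prc` — an `l^±`-procession whose index sets are literally `T.Caps j = Fin (j+1)`, with
"TODO-merge: abc-iut-L5-t4/L5-t5 ([IUTchI] Prop. 6.9)". Seat abc-iut-w4-d076 has since landed the REAL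
procession: `PMBaseKit.DThetaPMBridge.prcMono B M hl : Procession M.DMono ((l+1)/2)` ([IUTchI] Prop. 6.9 (ii):
the mono-analyticisation of `Prc(†𝔇_T)`, whose `t`-capsule is the sub-capsule of `†𝔇_{|T|}` on the classes
`q ∈ |T|` with `label(q) < t`, `PMBaseProcessionsPrc.lean`). This file resolves the TODO-merge:

* `LogShells.Ind1_eq_iUnion_aut_of_procession` — for ANY procession `P` ([IUTchI] Def. 4.10) and ANY level map
  `e` with bijections `β j : P.idx (e j) ≃ S^±_{j+1}` ("relative to the bijection `|T| ⥲ |𝔽_l|`", Prop. 6.9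
  (i) p. 169 l. 19), (Ind1) at label `j` is the union over the automorphisms `f` of `P` of the slices at the
  permutations `perm f (e j)` read through `β j` (K: automorphisms of a procession induce ALL families of
  permutations of its capsule index sets, `ProcessionAut.perm_surjective`);
* `LogShells.Ind1_eq_iUnion_aut_prcMono` — the case `P := Prc(†𝔇^⊢_T)` of a `𝒟`-`Θ^±`-bridge `B` of an
  abc-iut-L5-t4 base kit `K : PMBaseKit l` with `l^± = (l+1)/2 = l⋇ + 1` levels (`Fin.cast`), for every index
  datum `T` with `T.lstar + 1 = (l+1)/2` and every family of bijections `β`; `nonempty_idxEquiv_prcMono` — such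
  bijections EXIST (the `t`-capsule has exactly `t` constituents: L5's `Procession.card_idx`);
* `Real.lstar_add_one` / `Real.Ind1_logShells_eq_iUnion_aut_prcMono` — the specialisation to abc-iut-c312-5's
  real index datum `Real.thetaIndex X` of a pilot datum `X : PilotData F` (`X.l = 2·X.lstar + 1`) and real
  log-shells `Real.logShells X logv Aut Ism …`, for any kit with the same `l`.

What is NOT merged (neutral): the STRIP part of (Ind1) (the automorphisms `h i v ∈ stripAut v` of the
constituent `𝒟^⊢`-prime-strips acting on `log(𝒟^⊢_v)`) stays the binder `stripAut` of A's `LogShells` — at the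
M level it is the content of the reconstruction interfaces ([AbsTopIII] Prop. 5.8; abc-iut-L4-t3/L6-t1), at
the Dupuy–Hilado level it is trivial (c312-5's `Real.stripAutDH = {1}`, DH §4.1/§4.7); the constituents
`M.DMono` of the real procession play no role in the permutation part (Prop. 6.9 (ii) p. 170 l. 1: "the same indeterminacy
properties with respect to labels"). Sources read on the page (this seat's renders of `paper:url-4b091feeb646`,
`paper:url-690e7b3c6199`): [IUTchIII] p. 154 (Ind1); [IUTchI] p. 169 l. 19, l. 37–40, p. 170 l. 1–2 (Prop. 6.9). [claim: Mochizuki2012, status: disputed]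
typed ≠ proved; instantiated ≠ endorsed.
-/

namespace Summit.ABC.IUTFork.Thm311

open Literature.IUT.HodgeTheaters

universe u

namespace LogShells

variable {T : ThetaIndex} (L : LogShells T)

/-! ## 1. (Ind1) through ANY procession with the right capsule sizes -/

/-- **(Ind1) at label `j` = the automorphisms of ANY procession, read through index bijections.** For a
procession `P` ([IUTchI] Def. 4.10, abc-iut-L5-t3), a level map `e` and bijections `β j : P.idx (e j) ≃ S^±_{j+1}`,
A's `Ind1 j` is the union over the automorphisms `f : P ⟶ P` of the slices `ind1Of j σ` at
`σ := β ∘ perm f (e j) ∘ β⁻¹`. (K's `Ind1_eq_iUnion_perm` + `ProcessionAut.exists_perm_eq`.)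
[claim: Mochizuki2012, status: disputed] -/
theorem Ind1_eq_iUnion_aut_of_procession {C : Type u} {n : ℕ} (P : Procession C n) (e : T.Label → Fin n)
    (β : ∀ j : T.Label, P.idx (e j) ≃ T.Caps j) (j : T.Label) :
    L.Ind1 j = ⋃ f : P.Hom P, L.ind1Of j (((β j).symm.trans (ProcessionAut.perm f (e j))).trans (β j)) := by
  rw [L.Ind1_eq_iUnion_perm j]
  apply subset_antisymm
  · intro Φ hΦ
    obtain ⟨σ, hσ⟩ := Set.mem_iUnion.1 hΦ
    obtain ⟨f, hf⟩ := ProcessionAut.exists_perm_eq P (e j) (((β j).trans σ).trans (β j).symm)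
    refine Set.mem_iUnion.2 ⟨f, ?_⟩
    have hσ' : ((β j).symm.trans (ProcessionAut.perm f (e j))).trans (β j) = σ := by
      rw [hf]; ext i; simp
    rw [hσ']
    exact hσ
  · intro Φ hΦ
    obtain ⟨f, hf⟩ := Set.mem_iUnion.1 hΦ
    exact Set.mem_iUnion.2 ⟨_, hf⟩

/-! ## 2. (Ind1) through the REAL procession `Prc(†𝔇^⊢_T)` of [IUTchI] Prop. 6.9 (ii) -/

section Kit

variable {l : ℕ} {K : PMBaseKit.{u} l} (B : K.DThetaPMBridge) (M : K.MultKit) (hl : Odd l)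
  (h : T.lstar + 1 = (l + 1) / 2)

/-- Index bijections `|capsule of Prc(†𝔇^⊢_T) at level j| ≃ S^±_{j+1}` EXIST: the `(j+1)`-capsule of L5's
procession has exactly `j+1` constituents (`Procession.card_idx`; [IUTchI] Prop. 6.9 (i) p. 169 "there are
precisely `n` possibilities for the element `∈ |𝔽_l|` to which a given index […] corresponds", p. 169 l. 37–40). [claim: Mochizuki2012, status: disputed] -/
theorem nonempty_idxEquiv_prcMono (j : T.Label) :
    Nonempty ((B.prcMono M hl).idx (Fin.cast h j) ≃ T.Caps j) := by
  refine Finite.card_eq.1 ?_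
  rw [(B.prcMono M hl).card_idx (Fin.cast h j), Nat.card_eq_fintype_card, Fintype.card_fin]
  rfl

/-- **(Ind1) = the automorphisms of the REAL `l^±`-procession `Prc(†𝔇^⊢_T)`** (abc-iut-w4-d076's `prcMono` over
an abc-iut-L5-t4 base kit, [IUTchI] Prop. 6.9 (ii)), for every index datum `T` with `l⋇ + 1 = (l+1)/2 = l^±`
levels and every family of index bijections `β` (which exist: `nonempty_idxEquiv_prcMono`): A's `Ind1 j` is
the union over the automorphisms `f` of `Prc(†𝔇^⊢_T)` of the slices `ind1Of j (β ∘ perm f ∘ β⁻¹)` at the level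
`j` (levels matched by `Fin.cast`). [claim: Mochizuki2012, status: disputed] -/
theorem Ind1_eq_iUnion_aut_prcMono (β : ∀ j : T.Label, (B.prcMono M hl).idx (Fin.cast h j) ≃ T.Caps j)
    (j : T.Label) :
    L.Ind1 j = ⋃ f : (B.prcMono M hl).Hom (B.prcMono M hl),
      L.ind1Of j (((β j).symm.trans (ProcessionAut.perm f (Fin.cast h j))).trans (β j)) :=
  L.Ind1_eq_iUnion_aut_of_procession (B.prcMono M hl) (Fin.cast h) β j

/-- The (Ind1)-FAMILIES likewise (one automorphism of `Prc(†𝔇^⊢_T)` acting at every label): every family in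
B's `Ind1Family` arises from an automorphism of the real procession, and conversely.
[claim: Mochizuki2012, status: disputed] -/
theorem Ind1Family_eq_iUnion_aut_prcMono (β : ∀ j : T.Label, (B.prcMono M hl).idx (Fin.cast h j) ≃ T.Caps j) :
    L.Ind1Family = ⋃ f : (B.prcMono M hl).Hom (B.prcMono M hl),
      {Φ | ∀ j, (fun vQ => Φ j vQ) ∈
        L.ind1Of j (((β j).symm.trans (ProcessionAut.perm f (Fin.cast h j))).trans (β j))} := by
  apply subset_antisymm
  · intro Φ hΦ
    have hσ : ∀ j, ∃ σ : Equiv.Perm (T.Caps j), (fun vQ => Φ j vQ) ∈ L.ind1Of j σ := fun j => by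
      have := hΦ j
      rw [L.Ind1_eq_iUnion_perm j] at this
      exact Set.mem_iUnion.1 this
    choose σ hσ using hσ
    obtain ⟨f, hf⟩ := ProcessionAut.perm_surjective (B.prcMono M hl) fun n =>
      (((β (Fin.cast h.symm n)).trans (σ (Fin.cast h.symm n))).trans (β (Fin.cast h.symm n)).symm :
        Equiv.Perm ((B.prcMono M hl).idx n))
    refine Set.mem_iUnion.2 ⟨f, fun j => ?_⟩
    have hperm : ProcessionAut.perm f (Fin.cast h j) = ((β j).trans (σ j)).trans (β j).symm :=
      congrFun hf (Fin.cast h j)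
    have key : ((β j).symm.trans (ProcessionAut.perm f (Fin.cast h j))).trans (β j) = σ j := by
      rw [hperm]; ext i; simp
    rw [key]
    exact hσ j
  · intro Φ hΦ
    obtain ⟨f, hf⟩ := Set.mem_iUnion.1 hΦ
    intro j
    rw [L.Ind1_eq_iUnion_perm j]
    exact Set.mem_iUnion.2 ⟨_, hf j⟩

end Kit

end LogShells

/-! ## 3. The real index datum of abc-iut-c312-5 -/

namespace Real

open NumberField Literature.IUT.LogVolume

variable {F : Type} [Field F] [NumberField F] (X : PilotData F) (logv : PadicLogs F)
  (Aut Ism : ∀ x : Place F, Set (Carrier x ≃ₗ[ℚ] Carrier x))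
  (hAut : ∀ x, LinearEquiv.refl ℚ (Carrier x) ∈ Aut x) (hIsm : ∀ x, LinearEquiv.refl ℚ (Carrier x) ∈ Ism x)

/-- For c312-5's real index datum `l⋇ + 1 = (l+1)/2` (`PilotData.l_eq : l = 2·l⋇ + 1`). [folklore] -/
theorem lstar_add_one : (thetaIndex X).lstar + 1 = (X.l + 1) / 2 := by
  have h := X.l_eq
  show X.lstar + 1 = (X.l + 1) / 2
  omega

/-- **(Ind1) of the REAL log-shells `Real.logShells X …` = the automorphisms of the real procession
`Prc(†𝔇^⊢_T)`** of any `𝒟`-`Θ^±`-bridge of an abc-iut-L5-t4 base kit with the pilot datum's `l`, read through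
any family of index bijections (which exist). [claim: Mochizuki2012, status: disputed] -/
theorem Ind1_logShells_eq_iUnion_aut_prcMono {K : PMBaseKit.{u} X.l} (B : K.DThetaPMBridge) (M : K.MultKit)
    (hl : Odd X.l)
    (β : ∀ j : (thetaIndex X).Label, (B.prcMono M hl).idx (Fin.cast (lstar_add_one X) j) ≃ (thetaIndex X).Caps j)
    (j : (thetaIndex X).Label) :
    (logShells X logv Aut Ism hAut hIsm).Ind1 j = ⋃ f : (B.prcMono M hl).Hom (B.prcMono M hl),
      (logShells X logv Aut Ism hAut hIsm).ind1Of j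
        (((β j).symm.trans (ProcessionAut.perm f (Fin.cast (lstar_add_one X) j))).trans (β j)) :=
  (logShells X logv Aut Ism hAut hIsm).Ind1_eq_iUnion_aut_prcMono B M hl (lstar_add_one X) β j

/-- `X.l` is odd (`l = 2·l⋇ + 1`), so the kit hypothesis `Odd l` of L5's procession is met by the pilot datum.
[folklore] -/
theorem odd_l : Odd X.l := ⟨X.lstar, X.l_eq⟩

end Real

end Summit.ABC.IUTFork.Thm311
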